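import Summits.CriticalPhenomena.PercolationContinuityZ3.Theorems.PercNearOneGluingNoHeavyQuantKnConstants
import Literature.Probability.Percolation.UniquenessZone
import HarnessLib

/-!
# QUANT lane / PAPER-2 rate track (ARM-1, gen 5): the SMALL-BOX TRANSFER inclusion — a robust attachment to ONE
# small box transfers to every target, with no seed, no contact count and no junction input

builds on p205010 (kernel theorem, internal audit signed; external expert review pending)

Cell `prim-quant`, seat `prim-quant-arm-1` (rate-theorem architect), memo `run/shared/lean/prim/quant/RATE-PLAN.md` §14.
Kozma–Nitzan's Lemma 10 (arXiv:2401.12397 §4; tree `KozmaNitzanTargetLemma.lean`, effective form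
`Quant.targetLemma_thin`) converts `P(o ↔ B) > 1 − δ` into `P(o ↔ T) > 1 − ε` for a BIG intermediate set `B` (a
plaquette) at the price of seeds (Step III) and contact counting (Step II) — the two exponentials behind the tree's
iterated-logarithm rate (RATE-PLAN §2).  This proof-only file records the elementary fact that for a SMALL intermediate
set — the seed-scale box `Λ_m` sitting inside its uniqueness zone `Λ_M` — the same conversion is FREE:

* `Quant.not_mem_uniqZone_of_reach_of_not_reach` — the deterministic inclusion.  For a lattice configuration `ω`, sites
  `o, t ∉ Λ_M` and `x, y ∈ Λ_m` (`m ≤ M`): if `o ↔ x`, `y ↔ t` and `o ↮ t` then `ω ∉ uniqZone m M`.  (The open path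
  from `x` towards `o` leaves `Λ_M`, so `x ↔ ∂ⁱⁿΛ_M` inside `Λ_M`; likewise `y`; the uniqueness zone would join `x` to
  `y` inside `Λ_M`, whence `o ↔ t`.)
* `Quant.reach_inter_notReach_subset` — set form: for site sets `O, T` disjoint from `Λ_M`,
  `{O ↔ Λ_m} ∩ {Λ_m ↔ T} ∩ {O ↮ T} ⊆ (uniqZone m M)ᶜ` on lattice configurations.
* `Quant.real_reach_inter_notReach_le` — for every `p`:
  `P_p(O ↔ Λ_m, O ↮ T) ≤ P_p(Λ_m ↮ T) + P_p((uniqZone m M)ᶜ)`, and the "rigidity" form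
  `Quant.real_reach_le_real_reach_add`: `P_p(O ↔ Λ_m) ≤ P_p(O ↔ T) + P_p(Λ_m ↮ T) + P_p((uniqZone m M)ᶜ)`.
* `Quant.real_reach_inter_notReach_criticalProbI_le` — at `p_c(ℤ^d)`, `d ≥ 2`, with the lane's zone scale
  `M = knM d m` (`≈ m^{220}` for `d = 3`): `P_{p_c}(O ↔ Λ_m, O ↮ T) ≤ P_{p_c}(Λ_m ↮ T) + knTauU d`
  (DKT's Proposition 1 at criticality, `Quant.uniq_knM_criticalProbI`).
* the same around an arbitrary vertex `v` (cores `v + Λ_m = GM.ball v m`, zone `KozmaNitzan.uniqZoneAt v m M`, the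
  shape Step IV of the tree's target lemma uses): `Quant.not_mem_uniqZoneAt_of_reach_of_not_reach`,
  `Quant.real_reachAt_inter_notReach_le`, `Quant.real_reachAt_inter_notReach_criticalProbI_le`.

READING (RATE-PLAN §14; numbers, not adjectives).  In the counterfactual world of the finite-size criterion
(`Quant.slabPerc_of_finiteSizeInputs`: every hitting probability from `Λ_m` at scales `≤ W` is `≥ 1 − τ`) the source `O`
is the explored history and `T` a target; the lemma says that a history attached to the small core `Λ_m(v)` with
probability `1 − δ` is attached to ANY target `T` outside `Λ_M(v)` with probability `≥ 1 − δ − τ_T − u`, where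
`τ_T = P(Λ_m(v) ↮ T)` is an admissible hitting defect and `u = P((uniqZone m M)ᶜ) ≤ knTauU d` HOLDS at `p_c` — additive
constant loss, POLYNOMIAL room (`M = knM d m`), no seed, no Step II, no junction input `(J)`.  Hence the direction
"small intermediate set ⟹ any target" of Lemma 10 carries no tower; the ENTIRE super-polynomial cost of the
Kozma–Nitzan architecture sits in the converse direction "plaquette ⟹ small box" (the top-level exploration of KN's
Theorem 6, Step IV, certifies attachments to separating PLAQUETTES only), which is the junction problem of
P2-EFFECTIVE-KN §7.4 verbatim.  This sharpens RATE-PLAN §10.5's debt list; it does not change the honest sentence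
(log*-type rate PROVED; polylog and power law OPEN).  Proof-only file: no definitions, no named facts, no sorries.
[cite: KozmaNitzan2024, §4 pp. 17–22 (Lemma 10, Steps II–V)] [cite: MartineauTassion2017, §3.1.2 (uniqueness zone)]
[cite: DuminilcopinKozmaTassion2020, Proposition 1]
-/

noncomputable section

namespace Summit.CriticalPhenomena.PercolationContinuityZ3.Theorems.Quant

open MeasureTheory Literature.Probability.Percolation Literature.Probability.LatticeModels
open scoped Classical

variable {d : ℕ}

/-! ## Exiting the zone: an open path from `Λ_M` to a site outside `Λ_M` meets `∂ⁱⁿΛ_M` -/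

/-- **Exit lemma.**  On a lattice configuration `ω ⊆ E(ℤ^d)`, if `x ∈ Λ_M` is joined by an open path to a site
`o ∉ Λ_M`, then `x ↔ ∂ⁱⁿΛ_M` inside `Λ_M` (`ω ∈ toBdry M x`): stop the path at its first exit from `Λ_M`.
builds on p205010 (kernel theorem, internal audit signed; external expert review pending). [folklore] -/
theorem mem_toBdry_of_openConn_of_not_mem {M : ℕ} {ω : BondConfig (Site d)} (hω : ω ⊆ (zdGraph d).edgeSet)
    {x o : Site d} (hx : x ∈ box d M) (ho : o ∉ box d M) (hxo : ω ∈ openConn x o) : ω ∈ toBdry M x := by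
  have hpath : PathIn (openGraph ω) Set.univ x o := DCT16.pathIn_univ_of_reachable hxo
  obtain ⟨a, b, ha, hb, -, hab, hpa⟩ :=
    hpath.exit (R := (↑(box d M) : Set (Site d))) (Finset.mem_coe.2 hx) (fun h => ho (Finset.mem_coe.1 h))
  refine ⟨a, ?_, ?_⟩
  · rw [mem_innerBoundary_iff]
    exact ⟨Finset.mem_coe.1 ha, b, fun h' => hb (Finset.mem_coe.2 h'), DCT16.adj_of_openGraph_adj hω hab⟩
  · rw [DCT16.mem_openConnIn_iff_pathIn]
    exact hpa.mono Set.inter_subset_left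

/-! ## The deterministic inclusion -/

/-- **SMALL-BOX TRANSFER, pointwise.**  On a lattice configuration `ω ⊆ E(ℤ^d)`, let `m ≤ M`, `x, y ∈ Λ_m`,
`o, t ∉ Λ_M`.  If `o ↔ x`, `y ↔ t` and `o ↮ t`, then the uniqueness zone `uniqZone m M` FAILS: the clusters of `o` and of
`t` are two distinct clusters each joining `Λ_m` to `∂ⁱⁿΛ_M` inside `Λ_M`.
builds on p205010 (kernel theorem, internal audit signed; external expert review pending).
[cite: MartineauTassion2017, §3.1.2 (uniqueness zone)] -/
theorem not_mem_uniqZone_of_reach_of_not_reach {m M : ℕ} (hmM : m ≤ M) {ω : BondConfig (Site d)}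
    (hω : ω ⊆ (zdGraph d).edgeSet) {o t x y : Site d} (ho : o ∉ box d M) (ht : t ∉ box d M)
    (hx : x ∈ box d m) (hy : y ∈ box d m) (hox : ω ∈ openConn o x) (hyt : ω ∈ openConn y t)
    (hot : ω ∉ openConn o t) : ω ∉ uniqZone m M := by
  intro hU
  have hxM : x ∈ box d M := box_mono d hmM hx
  have hyM : y ∈ box d M := box_mono d hmM hy
  have hxo : ω ∈ openConn x o := SimpleGraph.Reachable.symm hox
  have hbx : ω ∈ toBdry M x := mem_toBdry_of_openConn_of_not_mem hω hxM ho hxo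
  have hby : ω ∈ toBdry M y := mem_toBdry_of_openConn_of_not_mem hω hyM ht hyt
  have hxy : ω ∈ openConnIn (↑(box d M) : Set (Site d)) x y := hU x hx y hy hbx hby
  have hxy' : (openGraph ω).Reachable x y := reachable_of_pathIn (DCT16.mem_openConnIn_iff_pathIn.1 hxy)
  exact hot ((SimpleGraph.Reachable.trans hox hxy').trans hyt)

/-- **SMALL-BOX TRANSFER, set form.**  For `m ≤ M` and site sets `O, T` disjoint from `Λ_M`, on lattice configurations:
`{O ↔ Λ_m} ∩ {Λ_m ↔ T} ∩ {O ↮ T} ⊆ (uniqZone m M)ᶜ`.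
builds on p205010 (kernel theorem, internal audit signed; external expert review pending).
[cite: MartineauTassion2017, §3.1.2 (uniqueness zone)] -/
theorem reach_inter_notReach_subset {m M : ℕ} (hmM : m ≤ M) {O T : Set (Site d)}
    (hO : ∀ o ∈ O, o ∉ box d M) (hT : ∀ t ∈ T, t ∉ box d M) {ω : BondConfig (Site d)}
    (hω : ω ⊆ (zdGraph d).edgeSet)
    (hOx : ω ∈ {ω : BondConfig (Site d) | ∃ o ∈ O, ∃ x ∈ box d m, ω ∈ openConn o x})
    (hyT : ω ∈ {ω : BondConfig (Site d) | ∃ y ∈ box d m, ∃ t ∈ T, ω ∈ openConn y t})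
    (hOT : ω ∉ {ω : BondConfig (Site d) | ∃ o ∈ O, ∃ t ∈ T, ω ∈ openConn o t}) :
    ω ∈ (uniqZone m M)ᶜ := by
  obtain ⟨o, hoO, x, hx, hox⟩ := hOx
  obtain ⟨y, hy, t, htT, hyt⟩ := hyT
  exact not_mem_uniqZone_of_reach_of_not_reach hmM hω (hO o hoO) (hT t htT) hx hy hox hyt
    (fun h => hOT ⟨o, hoO, t, htT, h⟩)

/-! ## Probability forms -/

/-- **SMALL-BOX TRANSFER, probability form** (every density `p`): for `m ≤ M` and site sets `O, T` disjoint from `Λ_M`,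
`P_p(O ↔ Λ_m, O ↮ T) ≤ P_p(Λ_m ↮ T) + P_p((uniqZone m M)ᶜ)`.
In the criterion's counterfactual world: a source attached to the core `Λ_m` with probability `1 − δ` is attached to
any target outside the zone with probability `≥ 1 − δ − P(Λ_m ↮ T) − P(uniqᶜ)` — additive loss, no seed, no contact
count, no junction input.  builds on p205010 (kernel theorem, internal audit signed; external expert review pending).
[cite: KozmaNitzan2024, §4 pp. 17–22 (Lemma 10)] [cite: MartineauTassion2017, §3.1.2 (uniqueness zone)] -/
theorem real_reach_inter_notReach_le (p : unitInterval) {m M : ℕ} (hmM : m ≤ M) {O T : Set (Site d)}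
    (hO : ∀ o ∈ O, o ∉ box d M) (hT : ∀ t ∈ T, t ∉ box d M) :
    (bondPercolation (zdGraph d) p).real
        ({ω : BondConfig (Site d) | ∃ o ∈ O, ∃ x ∈ box d m, ω ∈ openConn o x} ∩
          {ω : BondConfig (Site d) | ∃ o ∈ O, ∃ t ∈ T, ω ∈ openConn o t}ᶜ) ≤
      (bondPercolation (zdGraph d) p).real
          {ω : BondConfig (Site d) | ∃ y ∈ box d m, ∃ t ∈ T, ω ∈ openConn y t}ᶜ +
        (bondPercolation (zdGraph d) p).real (uniqZone (d := d) m M)ᶜ := by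
  refine (DCT16.real_mono_of_forall_subset_edgeSet (zdGraph d) p
    (B := {ω : BondConfig (Site d) | ∃ y ∈ box d m, ∃ t ∈ T, ω ∈ openConn y t}ᶜ ∪ (uniqZone (d := d) m M)ᶜ)
    (fun ω hω h => ?_)).trans (measureReal_union_le _ _)
  by_cases hyT : ω ∈ {ω : BondConfig (Site d) | ∃ y ∈ box d m, ∃ t ∈ T, ω ∈ openConn y t}
  · exact Or.inr (reach_inter_notReach_subset hmM hO hT hω h.1 hyT h.2)
  · exact Or.inl hyT

/-- **Rigidity form**: for `m ≤ M` and `O, T` disjoint from `Λ_M`,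
`P_p(O ↔ Λ_m) ≤ P_p(O ↔ T) + P_p(Λ_m ↮ T) + P_p((uniqZone m M)ᶜ)`.
builds on p205010 (kernel theorem, internal audit signed; external expert review pending).
[cite: KozmaNitzan2024, §4 pp. 17–22 (Lemma 10)] [cite: MartineauTassion2017, §3.1.2 (uniqueness zone)] -/
theorem real_reach_le_real_reach_add (p : unitInterval) {m M : ℕ} (hmM : m ≤ M) {O T : Set (Site d)}
    (hO : ∀ o ∈ O, o ∉ box d M) (hT : ∀ t ∈ T, t ∉ box d M) :
    (bondPercolation (zdGraph d) p).real
        {ω : BondConfig (Site d) | ∃ o ∈ O, ∃ x ∈ box d m, ω ∈ openConn o x} ≤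
      (bondPercolation (zdGraph d) p).real {ω : BondConfig (Site d) | ∃ o ∈ O, ∃ t ∈ T, ω ∈ openConn o t} +
        (bondPercolation (zdGraph d) p).real
            {ω : BondConfig (Site d) | ∃ y ∈ box d m, ∃ t ∈ T, ω ∈ openConn y t}ᶜ +
          (bondPercolation (zdGraph d) p).real (uniqZone (d := d) m M)ᶜ := by
  set μ := bondPercolation (zdGraph d) p with hμ
  set A := {ω : BondConfig (Site d) | ∃ o ∈ O, ∃ x ∈ box d m, ω ∈ openConn o x} with hA
  set B := {ω : BondConfig (Site d) | ∃ o ∈ O, ∃ t ∈ T, ω ∈ openConn o t} with hB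
  have hsplit : μ.real A ≤ μ.real (A ∩ B) + μ.real (A ∩ Bᶜ) :=
    (measureReal_mono (show A ⊆ (A ∩ B) ∪ (A ∩ Bᶜ) from fun ω hω => by
        by_cases hB' : ω ∈ B
        · exact Or.inl ⟨hω, hB'⟩
        · exact Or.inr ⟨hω, hB'⟩) (measure_ne_top _ _)).trans (measureReal_union_le _ _)
  have h1 : μ.real (A ∩ B) ≤ μ.real B := measureReal_mono Set.inter_subset_right (measure_ne_top _ _)
  have h2 := real_reach_inter_notReach_le p hmM hO hT (d := d)
  rw [← hμ] at h2
  linarith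

/-- **SMALL-BOX TRANSFER at criticality, at the lane's zone scale** (`d ≥ 2`, `M = knM d m`, every seed scale `m`):
for `O, T` disjoint from `Λ_{knM d m}`,
`P_{p_c}(O ↔ Λ_m, O ↮ T) ≤ P_{p_c}(Λ_m ↮ T) + knTauU d`
(DKT's Proposition 1 at `p_c` in the lane's closed form, `Quant.uniq_knM_criticalProbI`; `knTauU 3 < 2⁻²⁶¹`).  The only
model-dependent price of the transfer is the admissible hitting defect `P_{p_c}(Λ_m ↮ T)`.
builds on p205010 (kernel theorem, internal audit signed; external expert review pending).
[cite: DuminilcopinKozmaTassion2020, Proposition 1] [cite: KozmaNitzan2024, §4 pp. 17–22 (Lemma 10)] -/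
theorem real_reach_inter_notReach_criticalProbI_le (hd : 2 ≤ d) (m : ℕ) {O T : Set (Site d)}
    (hO : ∀ o ∈ O, o ∉ box d (knM d m)) (hT : ∀ t ∈ T, t ∉ box d (knM d m)) :
    (bondPercolation (zdGraph d) (criticalProbI d)).real
        ({ω : BondConfig (Site d) | ∃ o ∈ O, ∃ x ∈ box d m, ω ∈ openConn o x} ∩
          {ω : BondConfig (Site d) | ∃ o ∈ O, ∃ t ∈ T, ω ∈ openConn o t}ᶜ) ≤
      (bondPercolation (zdGraph d) (criticalProbI d)).real
          {ω : BondConfig (Site d) | ∃ y ∈ box d m, ∃ t ∈ T, ω ∈ openConn y t}ᶜ + knTauU d :=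
  (real_reach_inter_notReach_le (criticalProbI d) (lt_knM d m).le hO hT).trans
    (add_le_add le_rfl (uniq_knM_criticalProbI hd m))

/-! ## Around an arbitrary vertex `v` (the form the criterion uses: cores `v + Λ_m`, zones `v + Λ_M`) -/

/-- Exit lemma around `v`: on `ω ⊆ E(ℤ^d)`, if `x ∈ v + Λ_M` is joined to `o ∉ v + Λ_M` then `x ↔ ∂ⁱⁿ(v + Λ_M)` inside
`v + Λ_M` (`ω ∈ toBdryAt v M x`).  builds on p205010 (kernel theorem, internal audit signed; external expert review
pending). [folklore] -/
theorem mem_toBdryAt_of_openConn_of_not_mem {v : Site d} {M : ℕ} {ω : BondConfig (Site d)}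
    (hω : ω ⊆ (zdGraph d).edgeSet) {x o : Site d} (hx : x ∈ GM.ball v M) (ho : o ∉ GM.ball v M)
    (hxo : ω ∈ openConn x o) : ω ∈ KozmaNitzan.toBdryAt v M x := by
  have hpath : PathIn (openGraph ω) Set.univ x o := DCT16.pathIn_univ_of_reachable hxo
  obtain ⟨a, b, ha, hb, -, hab, hpa⟩ :=
    hpath.exit (R := (↑(GM.ball v M) : Set (Site d))) (Finset.mem_coe.2 hx) (fun h => ho (Finset.mem_coe.1 h))
  refine ⟨a, ?_, ?_⟩
  · rw [mem_innerBoundary_iff]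
    exact ⟨Finset.mem_coe.1 ha, b, fun h' => hb (Finset.mem_coe.2 h'), DCT16.adj_of_openGraph_adj hω hab⟩
  · rw [DCT16.mem_openConnIn_iff_pathIn]
    exact hpa.mono Set.inter_subset_left

/-- **SMALL-BOX TRANSFER around `v`, pointwise**: on `ω ⊆ E(ℤ^d)`, with `m ≤ M`, `x, y ∈ v + Λ_m`, `o, t ∉ v + Λ_M`:
`o ↔ x`, `y ↔ t`, `o ↮ t` ⟹ `ω ∉ uniqZoneAt v m M`.
builds on p205010 (kernel theorem, internal audit signed; external expert review pending).
[cite: KozmaNitzan2024, §4 p. 15 (Lemma 7)] [cite: MartineauTassion2017, §3.1.2 (uniqueness zone)] -/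
theorem not_mem_uniqZoneAt_of_reach_of_not_reach {v : Site d} {m M : ℕ} (hmM : m ≤ M)
    {ω : BondConfig (Site d)} (hω : ω ⊆ (zdGraph d).edgeSet) {o t x y : Site d} (ho : o ∉ GM.ball v M)
    (ht : t ∉ GM.ball v M) (hx : x ∈ GM.ball v m) (hy : y ∈ GM.ball v m) (hox : ω ∈ openConn o x)
    (hyt : ω ∈ openConn y t) (hot : ω ∉ openConn o t) : ω ∉ KozmaNitzan.uniqZoneAt v m M := by
  intro hU
  have hsub : ∀ z ∈ GM.ball v m, z ∈ GM.ball v M := fun z hz =>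
    KozmaNitzan.mem_ball_iff_sub.2 (box_mono d hmM (KozmaNitzan.mem_ball_iff_sub.1 hz))
  have hbx : ω ∈ KozmaNitzan.toBdryAt v M x :=
    mem_toBdryAt_of_openConn_of_not_mem hω (hsub x hx) ho (SimpleGraph.Reachable.symm hox)
  have hby : ω ∈ KozmaNitzan.toBdryAt v M y := mem_toBdryAt_of_openConn_of_not_mem hω (hsub y hy) ht hyt
  have hxy : ω ∈ openConnIn (↑(GM.ball v M) : Set (Site d)) x y := hU x hx y hy hbx hby
  have hxy' : (openGraph ω).Reachable x y := reachable_of_pathIn (DCT16.mem_openConnIn_iff_pathIn.1 hxy)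
  exact hot ((SimpleGraph.Reachable.trans hox hxy').trans hyt)

/-- **SMALL-BOX TRANSFER around `v`, probability form** (every `p`): for `m ≤ M` and site sets `O, T` disjoint from
`v + Λ_M`, `P_p(O ↔ v + Λ_m, O ↮ T) ≤ P_p(v + Λ_m ↮ T) + P_p((uniqZone m M)ᶜ)` (translation invariance of the zone,
`KozmaNitzan.real_uniqZoneAt_eq`).  builds on p205010 (kernel theorem, internal audit signed; external expert review pending).
[cite: KozmaNitzan2024, §4 pp. 17–22 (Lemma 10)] [cite: MartineauTassion2017, §3.1.2 (uniqueness zone)] -/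
theorem real_reachAt_inter_notReach_le (p : unitInterval) (v : Site d) {m M : ℕ} (hmM : m ≤ M)
    {O T : Set (Site d)} (hO : ∀ o ∈ O, o ∉ GM.ball v M) (hT : ∀ t ∈ T, t ∉ GM.ball v M) :
    (bondPercolation (zdGraph d) p).real
        ({ω : BondConfig (Site d) | ∃ o ∈ O, ∃ x ∈ GM.ball v m, ω ∈ openConn o x} ∩
          {ω : BondConfig (Site d) | ∃ o ∈ O, ∃ t ∈ T, ω ∈ openConn o t}ᶜ) ≤
      (bondPercolation (zdGraph d) p).real
          {ω : BondConfig (Site d) | ∃ y ∈ GM.ball v m, ∃ t ∈ T, ω ∈ openConn y t}ᶜ +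
        (bondPercolation (zdGraph d) p).real (uniqZone (d := d) m M)ᶜ := by
  have hcompl : (bondPercolation (zdGraph d) p).real (KozmaNitzan.uniqZoneAt v m M)ᶜ =
      (bondPercolation (zdGraph d) p).real (uniqZone (d := d) m M)ᶜ := by
    rw [probReal_compl_eq_one_sub (KozmaNitzan.measurableSet_uniqZoneAt v m M),
      probReal_compl_eq_one_sub (measurableSet_uniqZone m M), KozmaNitzan.real_uniqZoneAt_eq]
  rw [← hcompl]
  refine (DCT16.real_mono_of_forall_subset_edgeSet (zdGraph d) p
    (B := {ω : BondConfig (Site d) | ∃ y ∈ GM.ball v m, ∃ t ∈ T, ω ∈ openConn y t}ᶜ ∪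
      (KozmaNitzan.uniqZoneAt v m M)ᶜ)
    (fun ω hω h => ?_)).trans (measureReal_union_le _ _)
  by_cases hyT : ω ∈ {ω : BondConfig (Site d) | ∃ y ∈ GM.ball v m, ∃ t ∈ T, ω ∈ openConn y t}
  · obtain ⟨o, hoO, x, hx, hox⟩ := h.1
    obtain ⟨y, hy, t, htT, hyt⟩ := hyT
    exact Or.inr (not_mem_uniqZoneAt_of_reach_of_not_reach hmM hω (hO o hoO) (hT t htT) hx hy hox hyt
      (fun h' => h.2 ⟨o, hoO, t, htT, h'⟩))
  · exact Or.inl hyT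

/-- **SMALL-BOX TRANSFER around `v` at criticality, at the lane's zone scale** (`d ≥ 2`, `M = knM d m`): for `O, T`
disjoint from `v + Λ_{knM d m}`, `P_{p_c}(O ↔ v + Λ_m, O ↮ T) ≤ P_{p_c}(v + Λ_m ↮ T) + knTauU d`.
builds on p205010 (kernel theorem, internal audit signed; external expert review pending).
[cite: DuminilcopinKozmaTassion2020, Proposition 1] [cite: KozmaNitzan2024, §4 pp. 17–22 (Lemma 10)] -/
theorem real_reachAt_inter_notReach_criticalProbI_le (hd : 2 ≤ d) (v : Site d) (m : ℕ) {O T : Set (Site d)}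
    (hO : ∀ o ∈ O, o ∉ GM.ball v (knM d m)) (hT : ∀ t ∈ T, t ∉ GM.ball v (knM d m)) :
    (bondPercolation (zdGraph d) (criticalProbI d)).real
        ({ω : BondConfig (Site d) | ∃ o ∈ O, ∃ x ∈ GM.ball v m, ω ∈ openConn o x} ∩
          {ω : BondConfig (Site d) | ∃ o ∈ O, ∃ t ∈ T, ω ∈ openConn o t}ᶜ) ≤
      (bondPercolation (zdGraph d) (criticalProbI d)).real
          {ω : BondConfig (Site d) | ∃ y ∈ GM.ball v m, ∃ t ∈ T, ω ∈ openConn y t}ᶜ + knTauU d :=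
  (real_reachAt_inter_notReach_le (criticalProbI d) v (lt_knM d m).le hO hT).trans
    (add_le_add le_rfl (uniq_knM_criticalProbI hd m))

end Summit.CriticalPhenomena.PercolationContinuityZ3.Theorems.Quant

end
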